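import Summits.Ventures.CertifiedArithmetic.LowPrec.SRPythagorasLiability
import HarnessLib

/-!
# CXXI — The liability potential (II): residue arithmetic, cost domination, reachable states, and
# TWO-RUN windows

HONEST FRAMING: certified error envelopes and provably optimal rounding/accumulation schemes for
low-precision formats under stated cost models; every table by two implementations; no hardware or
vendor claims.

Second file of the liability series (CXX: `pairLiab`, `PairLE`, the accounting theorem).  Proved here
(exact, over any linearly ordered field with floor):
* §1 residue arithmetic for `ℓ_E(a,b) = |a − b|·((−|a − b|) mod E)`: `resid_eq_self`, `resid_le_self`,
  `resid_sub_le`; COST DOMINATION `costdom` — for `c ≤ c'` and any base point `D`,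
  `(c' − c)·((c − D) mod E − y) ≤ ℓ_E(c, c') + (c − c')·(y − (c' − D) mod E)` (the quantitative form of
  CXIX's aligned monotonicity of the truncation); `pairLiab_eq_zero_of_grid` (points of a lattice of
  mesh `2^M·E` owe nothing); `vslackQ_nonneg`; `dyadic_split` (two dyadic scales: one divides the
  other); `resid_mul_eq_int`; `pairLiab_of_le`; and the THREE-LIABILITY inequality `ell3_le`:
  `ℓ(a+f, a+Δ) + ℓ(a, a+Δ+f) − 2ℓ(a, a+Δ) + f² ≤ B` for a lattice separation `Δ ∈ f·ℕ`, `f ≤ Δ`, dyadic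
  `f` versus `E`, whenever `(Δ + f)·E ≤ B` and `f² ≤ B` — the engine of the fine/fine case of CXXII.
* §2 `reach_window`, `reach_mem_window` — states of a no-saturation tree inside a window have their
  pre-rounding values in the window, and states of a positive level are window points of `F`;
  `liabQ_nonneg`; the structure `TwoRunWindow F lo mid hi g i J` — a nested window (CVI/CXIV) made of a
  FINE RUN `[lo, mid]` of cells of width `f = 2^i·g` and a TOP RUN `[mid, hi]` of cells of width
  `G = 2^J·g`, `i ≤ J` ARBITRARY (jump `2^{J−i}` unbounded), window points on `lo + f·ℤ`, top points on
  `mid + G·ℤ`; its cell-data lemmas `topData`, `fineData` (width, truncation `= (c − ⌊c̄⌋) mod (w/2^N)`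
  by CXIV `stepQA_cell`, lattice coordinates, the StochasticA probability), `exactData`, `exact_of_grid`.

Nothing in this file is specific to a number of random bits; no claim beyond the stated lemmas.
References: [ConnollyHighamMary2021], [ElararEtAl2025], [FitzgibbonFelix2025].
-/

namespace Summit.Ventures.CertifiedArithmetic.LowPrec.SR

open Literature.ComputerArithmetic.ConnollyHighamMary2021
open Finset

variable {K : Type*} [Field K] [LinearOrder K] [IsStrictOrderedRing K] [FloorRing K]

namespace LimitedBits

/-! ### 1. Residue arithmetic and the cost-domination inequality -/

/-- A number already in `[0, E)` is its own residue. -/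
theorem resid_eq_self {r E : K} (hE : 0 < E) (h0 : 0 ≤ r) (h1 : r < E) : resid r E = r := by
  unfold resid
  have h : ⌊r / E⌋ = 0 := Int.floor_eq_zero_iff.mpr ⟨div_nonneg h0 hE.le, (div_lt_one hE).mpr h1⟩
  rw [h]; simp

/-- The residue of a nonnegative number does not exceed it. -/
theorem resid_le_self {a E : K} (hE : 0 < E) (ha : 0 ≤ a) : resid a E ≤ a := by
  unfold resid
  have h : (0 : K) ≤ ⌊a / E⌋ := by exact_mod_cast Int.floor_nonneg.mpr (div_nonneg ha hE.le)
  nlinarith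

/-- Sub-additivity of residues: `(a mod E) − (a' mod E) ≤ (a − a') mod E`. -/
theorem resid_sub_le {a a' E : K} (hE : 0 < E) : resid a E - resid a' E ≤ resid (a - a') E := by
  have e : a - a' = (resid a E - resid a' E) + ((⌊a / E⌋ - ⌊a' / E⌋ : ℤ) : K) * E := by
    unfold resid; push_cast; ring
  rw [e, resid_add_mul hE]
  have ha := resid_nonneg_lt (y := a) hE
  have ha' := resid_nonneg_lt (y := a') hE
  by_cases hr : 0 ≤ resid a E - resid a' E
  · rw [resid_eq_self hE hr (by linarith)]
  · linarith [(resid_nonneg_lt (y := resid a E - resid a' E) hE).1]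

/-- **Cost domination.**  For `c ≤ c'` and any reference point `D`:
`(c' − c)·((c − D) mod E − y) ≤ ℓ_E(c, c') + (c − c')·(y − (c' − D) mod E)`; in particular, when the
mean truncation `y` of `c` is at most `(c − D) mod E` and that of `c'` equals `(c' − D) mod E`, the
liability of the pair dominates its (negative) covariance cost. -/
theorem costdom {E c c' D : K} (hE : 0 < E) (hcc : c ≤ c') (y : K) :
    (c' - c) * (resid (c - D) E - y) ≤ pairLiab E c c' + (c - c') * (y - resid (c' - D) E) := by
  have h3 := resid_sub_le (a := c - D) (a' := c' - D) hE
  rw [show c - D - (c' - D) = c - c' by ring] at h3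
  unfold pairLiab
  rw [abs_of_nonpos (sub_nonpos.mpr hcc), neg_neg]
  nlinarith [mul_le_mul_of_nonneg_left h3 (sub_nonneg.mpr hcc)]

/-- Two points congruent to a common base modulo a multiple `w = M·E` of `E` have no liability. -/
theorem pairLiab_eq_zero_of_grid {E m a b w : K} (hE : 0 < E) (M : ℕ) (hw : w = 2 ^ M * E)
    {za zb : ℤ} (ha : a - m = za * w) (hb : b - m = zb * w) : pairLiab E a b = 0 :=
  pairLiab_eq_zero_of_dvd hE (z := (za - zb) * 2 ^ M)
    (by push_cast; linear_combination ha - hb + ((za : K) - zb) * hw)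

omit [FloorRing K] in
/-- The variance slack is nonnegative when the cell is at most `G` wide. -/
theorem vslackQ_nonneg (F : Finset K) {q : K → K}
    (hq01 : ∀ θ, 0 ≤ θ → θ ≤ 1 → 0 ≤ q θ ∧ q θ ≤ 1) {G c : K} (hw0 : 0 ≤ up F c - dn F c)
    (hwG : up F c - dn F c ≤ G) : 0 ≤ vslackQ F q G c := by
  unfold vslackQ
  obtain ⟨h0, h1⟩ := pUpQ_mem F hq01 c
  have hpq : pUpQ F q c * (1 - pUpQ F q c) ≤ 1 / 4 := by linarith [sq_nonneg (pUpQ F q c - 1 / 2)]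
  have hG2 : (up F c - dn F c) ^ 2 ≤ G ^ 2 := pow_le_pow_left₀ hw0 hwG 2
  nlinarith [mul_nonneg h0 (sub_nonneg.mpr h1), sq_nonneg (up F c - dn F c)]

/-- Dyadic comparison of a fine width `f = 2^i·g` with `E = 2^J·g/2^N`: either `f` is a multiple
of `E`, or `E` is a proper multiple of `f`. -/
theorem dyadic_split {g : K} (hg : 0 < g) (i J N : ℕ) :
    (∃ d : ℕ, (2 : K) ^ i * g = 2 ^ d * (2 ^ J * g / 2 ^ N)) ∨
      (∃ m : ℕ, (2 : K) ^ J * g / 2 ^ N = 2 ^ m * (2 ^ i * g) ∧ (2 : K) ^ i * g < 2 ^ J * g / 2 ^ N) := by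
  have hGE : (2 : K) ^ J * g = 2 ^ N * (2 ^ J * g / 2 ^ N) := by field_simp
  by_cases h : J ≤ i + N
  · left
    obtain ⟨d, hd⟩ : ∃ d, i + N = J + d := ⟨i + N - J, by omega⟩
    refine ⟨d, ?_⟩
    apply mul_right_cancel₀ (show (2 : K) ^ N ≠ 0 by positivity)
    calc (2 : K) ^ i * g * 2 ^ N = 2 ^ (i + N) * g := by rw [pow_add]; ring
      _ = 2 ^ (J + d) * g := by rw [hd]
      _ = 2 ^ d * (2 ^ N * (2 ^ J * g / 2 ^ N)) := by rw [pow_add, ← hGE]; ring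
      _ = 2 ^ d * (2 ^ J * g / 2 ^ N) * 2 ^ N := by ring
  · right
    push Not at h
    obtain ⟨m, hm⟩ : ∃ m, J = i + N + m := ⟨J - (i + N), by omega⟩
    have hm1 : 1 ≤ m := by omega
    have e : (2 : K) ^ J * g / 2 ^ N = 2 ^ m * (2 ^ i * g) := by
      apply mul_right_cancel₀ (show (2 : K) ^ N ≠ 0 by positivity)
      calc (2 : K) ^ J * g / 2 ^ N * 2 ^ N = 2 ^ J * g := by field_simp
        _ = 2 ^ (i + N + m) * g := by rw [hm]
        _ = 2 ^ m * (2 ^ i * g) * 2 ^ N := by rw [pow_add, pow_add]; ring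
    refine ⟨m, e, ?_⟩
    rw [e]
    have hf : (0 : K) < 2 ^ i * g := by positivity
    exact lt_mul_of_one_lt_left hf (one_lt_pow₀ (by norm_num) (by omega))

/-- Residues on a lattice: `(w·f) mod (M·f) = k·f` with an integer `0 ≤ k < M`. -/
theorem resid_mul_eq_int {f : K} (hf : 0 < f) (M : ℕ) (hM : 0 < M) (w : ℤ) :
    ∃ k : ℤ, 0 ≤ k ∧ k < M ∧ resid ((w : K) * f) ((M : K) * f) = k * f := by
  have hMf : (0 : K) < (M : K) * f := by positivity
  obtain ⟨h0, h1⟩ := resid_nonneg_lt (y := (w : K) * f) hMf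
  have he : resid ((w : K) * f) ((M : K) * f)
      = ((w - M * ⌊(w : K) * f / ((M : K) * f)⌋ : ℤ) : K) * f := by
    unfold resid; push_cast; ring
  rw [he] at h0 h1
  refine ⟨w - M * ⌊(w : K) * f / ((M : K) * f)⌋, ?_, ?_, he⟩
  · have : (0 : K) ≤ ((w - M * ⌊(w : K) * f / ((M : K) * f)⌋ : ℤ) : K) := by
      by_contra hlt; push Not at hlt; nlinarith
    exact_mod_cast this
  · have : ((w - M * ⌊(w : K) * f / ((M : K) * f)⌋ : ℤ) : K) < (M : K) := by
      by_contra hle; push Not at hle; nlinarith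
    exact_mod_cast this

/-- The liability of an ordered pair in closed form. -/
theorem pairLiab_of_le {E a b : K} (hab : a ≤ b) : pairLiab E a b = (b - a) * resid (-(b - a)) E := by
  unfold pairLiab
  rw [abs_of_nonpos (sub_nonpos.mpr hab), show -(b - a) = a - b by ring, neg_neg]; ring

/-- **The three-liability inequality** (the heart of the fine/fine case): for a separation `Δ ≥ f`
on the lattice `f·ℤ`, with `f` and `E` dyadically comparable,
`ℓ(a+f, a+Δ) + ℓ(a, a+Δ+f) − 2·ℓ(a, a+Δ) + f² ≤ B` as soon as `(Δ+f)·E ≤ B` and `f² ≤ B`. -/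
theorem ell3_le {E f Δ B : K} (hE : 0 < E) (hf : 0 < f) (hfΔ : f ≤ Δ) {z : ℤ} (hz : Δ = z * f)
    (hdiv : (∃ d : ℕ, f = 2 ^ d * E) ∨ (∃ m : ℕ, E = 2 ^ m * f ∧ f < E))
    (hB : (Δ + f) * E ≤ B) (hfB : f ^ 2 ≤ B) (a : K) :
    pairLiab E (a + f) (a + Δ) + pairLiab E a (a + Δ + f) - 2 * pairLiab E a (a + Δ) + f ^ 2 ≤ B := by
  rw [pairLiab_of_le (show a + f ≤ a + Δ by linarith), pairLiab_of_le (show a ≤ a + Δ + f by linarith),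
    pairLiab_of_le (show a ≤ a + Δ by linarith),
    show a + Δ - (a + f) = Δ - f by ring, show a + Δ + f - a = Δ + f by ring, show a + Δ - a = Δ by ring]
  rcases hdiv with ⟨d, hd⟩ | ⟨m, hm, hfE⟩
  · -- every separation is a multiple of `E`: all three liabilities vanish
    rw [show -(Δ - f) = (((1 - z) * 2 ^ d : ℤ) : K) * E by push_cast; rw [hz, hd]; ring,
      show -(Δ + f) = (((-1 - z) * 2 ^ d : ℤ) : K) * E by push_cast; rw [hz, hd]; ring,
      show -Δ = ((-z * 2 ^ d : ℤ) : K) * E by push_cast; rw [hz, hd]; ring,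
      resid_int_mul hE, resid_int_mul hE, resid_int_mul hE]
    linarith
  · -- `E = 2^m·f`, `f < E`: the residue `r = (−Δ) mod E` is on the lattice `f·ℤ`
    obtain ⟨k, hk0, hkM, hk⟩ := resid_mul_eq_int hf (2 ^ m) (by positivity) (-z)
    have hr : resid (-Δ) E = (k : K) * f := by
      rw [show -Δ = ((-z : ℤ) : K) * f by rw [hz]; push_cast; ring, hm]
      push_cast at hk ⊢
      exact hk
    have hrb := resid_nonneg_lt (y := -Δ) hE
    have hj : -Δ = resid (-Δ) E + (⌊-Δ / E⌋ : ℤ) * E := by unfold resid; ring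
    rw [show -(Δ - f) = (resid (-Δ) E + f) + (⌊-Δ / E⌋ : ℤ) * E by linear_combination hj,
      show -(Δ + f) = (resid (-Δ) E - f) + (⌊-Δ / E⌋ : ℤ) * E by linear_combination hj,
      resid_add_mul hE, resid_add_mul hE]
    rcases Int.lt_or_le k 1 with hk1 | hk1
    · -- `r = 0`: phases agree; the far liability is `(Δ+f)(E−f)`
      have : k = 0 := by omega
      rw [this, Int.cast_zero, zero_mul] at hr
      rw [hr, zero_add, zero_sub, resid_eq_self hE hf.le hfE,
        show -f = (E - f) + ((-1 : ℤ) : K) * E by push_cast; ring, resid_add_mul hE,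
        resid_eq_self hE (by linarith) (by linarith)]
      nlinarith [hB, sq_nonneg f]
    · -- `r ≥ f`: the near liability drops by `f`, the sum is `≤ −f²`
      have hk1' : (1 : K) ≤ (k : K) := by exact_mod_cast hk1
      have hrf : f ≤ resid (-Δ) E := by rw [hr]; nlinarith
      rw [resid_eq_self hE (r := resid (-Δ) E - f) (by linarith) (by linarith [hrb.2])]
      have h1 := resid_le_self hE (a := resid (-Δ) E + f) (by linarith [hrb.1])
      nlinarith [mul_le_mul_of_nonneg_left h1 (sub_nonneg.mpr hfΔ), hfB, sq_nonneg f, hrb.1]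

/-! ### 2. Reachable states and two-run windows -/

omit [IsStrictOrderedRing K] [FloorRing K] in
/-- Every state reached at level `k < n` of a no-saturation tree inside the window has its next
pre-rounding value in the hull and in the window. -/
theorem reach_window (F : Finset K) (lo hi : K) :
    ∀ (k : ℕ) (x : ℕ → K) (s : K) (n : ℕ) (t : K), Reach F x s k t → k < n → NoSat F x n s →
      InWindow F lo hi x n s → InHull F (t + x k) ∧ lo ≤ t + x k ∧ t + x k ≤ hi := by
  intro k
  induction k with
  | zero =>
    intro x s n t ht hkn hns hw
    obtain ⟨m, rfl⟩ : ∃ m, n = m + 1 := ⟨n - 1, by omega⟩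
    simp only [Reach] at ht
    subst ht
    simp only [NoSat, InWindow] at hns hw
    obtain ⟨hh, -, -⟩ := hns
    obtain ⟨⟨h1, h2⟩, -, -⟩ := hw
    rw [clamp_eq_self hh] at h1 h2
    exact ⟨hh, h1, h2⟩
  | succ k ih =>
    intro x s n t ht hkn hns hw
    obtain ⟨m, rfl⟩ : ∃ m, n = m + 1 := ⟨n - 1, by omega⟩
    simp only [Reach] at ht
    simp only [NoSat, InWindow] at hns hw
    obtain ⟨-, hnu, hnd⟩ := hns
    obtain ⟨-, hwu, hwd⟩ := hw
    rcases ht with h | h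
    · exact ih _ _ m t h (by omega) hnu hwu
    · exact ih _ _ m t h (by omega) hnd hwd

omit [IsStrictOrderedRing K] in
/-- A state reached at a positive level is a candidate of a pre-rounding value in the window, hence a
member of `F` inside the window (for a nested window, whose end points are members). -/
theorem reach_mem_window {F : Finset K} {lo hi g : K} {J : ℕ} (hW : NestedWindow F lo hi g J) :
    ∀ (k : ℕ) (x : ℕ → K) (s : K) (n : ℕ) (t : K), Reach F x s (k + 1) t → k + 1 ≤ n →
      NoSat F x n s → InWindow F lo hi x n s → t ∈ F ∧ lo ≤ t ∧ t ≤ hi := by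
  intro k
  induction k with
  | zero =>
    intro x s n t ht hkn hns hw
    obtain ⟨-, h1, h2⟩ := reach_window F lo hi 0 x s n s (by simp only [Reach]) (by omega) hns hw
    obtain ⟨hdF, huF, hlod, huhi, hdc, hcu⟩ := hW.cand h1 h2
    simp only [Reach] at ht
    rcases ht with h | h
    · rw [h]; exact ⟨huF, hlod.trans (hdc.trans hcu), huhi⟩
    · rw [h]; exact ⟨hdF, hlod, (hdc.trans hcu).trans huhi⟩
  | succ k ih =>
    intro x s n t ht hkn hns hw
    obtain ⟨m, rfl⟩ : ∃ m, n = m + 1 := ⟨n - 1, by omega⟩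
    have ht' : Reach F (fun i => x (i + 1)) (up F (s + x 0)) (k + 1) t ∨
        Reach F (fun i => x (i + 1)) (dn F (s + x 0)) (k + 1) t := by
      simp only [Reach] at ht ⊢; exact ht
    simp only [NoSat, InWindow] at hns hw
    obtain ⟨-, hnu, hnd⟩ := hns
    obtain ⟨-, hwu, hwd⟩ := hw
    rcases ht' with h | h
    · exact ih _ _ m t h (by omega) hnu hwu
    · exact ih _ _ m t h (by omega) hnd hwd

/-- The liability of a state distribution is nonnegative. -/
theorem liabQ_nonneg (F : Finset K) {q : K → K}
    (hq01 : ∀ θ, 0 ≤ θ → θ ≤ 1 → 0 ≤ q θ ∧ q θ ≤ 1) {E : K} (hE : 0 < E) (x : ℕ → K) (k : ℕ)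
    (s : K) : 0 ≤ liabQ F q E x k s := by
  have h0 : acc2 F q x k (fun _ _ => (0 : K)) s = 0 := by
    unfold acc2
    have e : (fun t : K => accExpQ F q x k (fun _ : K => (0 : K)) s) = fun _ : K => (0 : K) := by
      funext t; exact accExpQ_const F q 0 k x s
    rw [e]; exact accExpQ_const F q 0 k x s
  unfold liabQ
  rw [← h0]
  exact acc2_mono_reach F hq01 k x s _ _ (fun t t' _ _ => pairLiab_nonneg hE t t')

/-- `TwoRunWindow F lo mid hi g i J`: the window `[lo, hi]` of `F` is a nested window (all gaps
`2^j·g`, `j ≤ J`) consisting of a FINE RUN `[lo, mid]` of cells of the single width `2^i·g` followed by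
a TOP RUN `[mid, hi]` of cells of the maximal width `2^J·g` — an (unbounded-)JUMP window: the cell
width jumps by the factor `2^{J−i}` at `mid`.  (`fgrid`/`tgrid` record the two lattices; they follow
from the run structure and are kept as fields for convenience.) -/
structure TwoRunWindow (F : Finset K) (lo mid hi g : K) (i J : ℕ) : Prop where
  nested : NestedWindow F lo hi g J
  mid_mem : mid ∈ F
  lo_le_mid : lo ≤ mid
  mid_le_hi : mid ≤ hi
  i_le : i ≤ J
  fine : ∀ c, lo ≤ c → c ≤ mid → up F c ≠ dn F c → up F c - dn F c = 2 ^ i * g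
  top : ∀ c, mid ≤ c → c ≤ hi → up F c ≠ dn F c → up F c - dn F c = 2 ^ J * g
  fgrid : ∀ a ∈ F, lo ≤ a → a ≤ hi → ∃ z : ℤ, a - lo = z * (2 ^ i * g)
  tgrid : ∀ a ∈ F, mid ≤ a → a ≤ hi → ∃ z : ℤ, a - mid = z * (2 ^ J * g)

namespace TwoRunWindow

variable {F : Finset K} {lo mid hi g : K} {i J : ℕ}

/-- Data of a point of the TOP run: its lower candidate is on the top lattice, its cell is trivial or
`G` wide, and its mean truncation under StochasticA is `(c − ⌊c̄⌋) mod E`, `E = G/2^N`. -/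
theorem topData (hW : TwoRunWindow F lo mid hi g i J) (hlo : 0 ≤ lo) (N : ℕ) {c : K}
    (h1 : mid ≤ c) (h2 : c ≤ hi) :
    (∃ z : ℤ, dn F c - mid = z * (2 ^ J * g)) ∧
      (up F c = dn F c ∨ up F c = dn F c + 2 ^ J * g) ∧
      truncQ F (probAwayA N) c = resid (c - dn F c) (2 ^ J * g / 2 ^ N) ∧
      mid ≤ dn F c ∧ dn F c ≤ c ∧ c ≤ up F c ∧ up F c ≤ hi := by
  have hl1 : lo ≤ c := hW.lo_le_mid.trans h1
  obtain ⟨hdF, -, hlod, huhi, hdc, hcu⟩ := hW.nested.cand hl1 h2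
  have hmd : mid ≤ dn F c := le_dn_of_mem hW.mid_mem h1
  have hg := hW.nested.pos
  have hwid : up F c = dn F c ∨ up F c = dn F c + 2 ^ J * g := by
    by_cases he : up F c = dn F c
    · exact Or.inl he
    · exact Or.inr (by linarith [hW.top c h1 h2 he])
  refine ⟨hW.tgrid _ hdF hmd (hdc.trans h2), hwid, ?_, hmd, hdc, hcu, huhi⟩
  unfold truncQ
  have hρ : (0 : K) < 2 ^ J * g / 2 ^ N := by positivity
  have e : (2 : K) ^ N * (2 ^ J * g / 2 ^ N) = 2 ^ J * g := by field_simp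
  rw [stepQA_cell F N (hW.nested.inHull hl1 h2) (hlo.trans hlod) hρ (by rw [e]; exact hwid)]
  ring

/-- Data of a NON-REPRESENTABLE point of the FINE run. -/
theorem fineData (hW : TwoRunWindow F lo mid hi g i J) (hlo : 0 ≤ lo) (N : ℕ) {c : K}
    (h1 : lo ≤ c) (h2 : c < mid) (hne : up F c ≠ dn F c) :
    up F c - dn F c = 2 ^ i * g ∧
      truncQ F (probAwayA N) c = resid (c - dn F c) (2 ^ i * g / 2 ^ N) ∧
      up F c ≤ mid ∧ lo ≤ dn F c ∧ (∃ z : ℤ, dn F c - lo = z * (2 ^ i * g)) ∧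
      dn F c < c ∧ c < up F c ∧
      pUpQ F (probAwayA N) c = probAwayA N ((c - dn F c) / (up F c - dn F c)) := by
  have h2' : c ≤ hi := h2.le.trans hW.mid_le_hi
  obtain ⟨hdF, huF, hlod, huhi, hdc, hcu⟩ := hW.nested.cand h1 h2'
  have hum : up F c ≤ mid := up_le_of_mem hW.mid_mem h2.le
  have hg := hW.nested.pos
  have hw := hW.fine c h1 h2.le hne
  have key : c ∈ F → False := fun hcF =>
    hne (le_antisymm ((up_le_of_mem hcF le_rfl).trans (le_dn_of_mem hcF le_rfl)) (dn_le_up F c))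
  have hdlt : dn F c < c := by
    rcases lt_or_eq_of_le hdc with h | h
    · exact h
    · exact (key (h ▸ hdF)).elim
  have hult : c < up F c := by
    rcases lt_or_eq_of_le hcu with h | h
    · exact h
    · exact (key (h.symm ▸ huF)).elim
  refine ⟨hw, ?_, hum, hlod, hW.fgrid _ hdF hlod (hdc.trans h2'), hdlt, hult, ?_⟩
  · unfold truncQ
    have hρ : (0 : K) < 2 ^ i * g / 2 ^ N := by positivity
    have e : up F c = dn F c + (2 : K) ^ N * (2 ^ i * g / 2 ^ N) := by
      rw [show (2 : K) ^ N * (2 ^ i * g / 2 ^ N) = 2 ^ i * g by field_simp]; linarith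
    rw [stepQA_cell F N (hW.nested.inHull h1 h2') (hlo.trans hlod) hρ (Or.inr e)]
    ring
  · unfold pUpQ
    rw [if_pos (hlo.trans hlod)]
    congr 1
    have hcl := clamp_eq_self (hW.nested.inHull h1 h2')
    unfold pUp probUp dn up; rw [hcl]

omit [IsStrictOrderedRing K] in
/-- Data of a REPRESENTABLE point (trivial cell). -/
theorem exactData (hW : TwoRunWindow F lo mid hi g i J) (q : K → K) {c : K} (h1 : lo ≤ c)
    (h2 : c ≤ hi) (he : up F c = dn F c) :
    c ∈ F ∧ dn F c = c ∧ up F c = c ∧ truncQ F q c = 0 ∧ ∃ z : ℤ, c - lo = z * (2 ^ i * g) := by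
  obtain ⟨hdF, -, -, -, hdc, hcu⟩ := hW.nested.cand h1 h2
  have hd : dn F c = c := le_antisymm hdc (he ▸ hcu)
  have hcF : c ∈ F := hd ▸ hdF
  refine ⟨hcF, hd, he.trans hd, ?_, hW.fgrid c hcF h1 h2⟩
  unfold truncQ stepQ; rw [he, hd]; ring

/-- A point of the fine run on the fine lattice is representable. -/
theorem exact_of_grid (hW : TwoRunWindow F lo mid hi g i J) (hlo : 0 ≤ lo) {a : K} (h1 : lo ≤ a)
    (h2 : a ≤ mid) {z : ℤ} (hz : a - lo = z * (2 ^ i * g)) : up F a = dn F a := by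
  by_contra hne
  rcases eq_or_lt_of_le h2 with h | h
  · subst h
    obtain ⟨-, -, -, -, hdc, hcu⟩ := hW.nested.cand h1 hW.mid_le_hi
    exact hne (le_antisymm ((up_le_of_mem hW.mid_mem le_rfl).trans
      (le_dn_of_mem hW.mid_mem le_rfl)) (dn_le_up F _))
  · obtain ⟨hw, -, -, -, ⟨z₂, hz₂⟩, hdlt, hult⟩ := hW.fineData hlo 0 h1 h hne
    have hf : (0 : K) < 2 ^ i * g := by have := hW.nested.pos; positivity
    have e : a - dn F a = ((z - z₂ : ℤ) : K) * (2 ^ i * g) := by push_cast; linarith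
    have k0 : (0 : K) < ((z - z₂ : ℤ) : K) := by
      by_contra hk; push Not at hk; nlinarith
    have k1 : ((z - z₂ : ℤ) : K) < 1 := by
      by_contra hk; push Not at hk; nlinarith
    have k0' : (0 : ℤ) < z - z₂ := by exact_mod_cast k0
    have k1' : z - z₂ < (1 : ℤ) := by exact_mod_cast k1
    omega

end TwoRunWindow

end LimitedBits

end Summit.Ventures.CertifiedArithmetic.LowPrec.SR
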